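import Mathlib
import HarnessLib
import Summits.ResolutionOfSingularities.ResolutionOfSingularities.Theorems.WildQuotientsWildQuotientResolutionS1KillExitDefs
import Summits.ResolutionOfSingularities.ResolutionOfSingularities.Theorems.WildQuotientsWildQuotientResolutionS1KillExitDefsTame
import Summits.ResolutionOfSingularities.ResolutionOfSingularities.Theorems.WildQuotientsWildQuotientResolutionStubQuotientModel
import Summits.ResolutionOfSingularities.ResolutionOfSingularities.Theorems.WildQuotientsWildQuotientResolutionStubBirational
import Literature.AlgebraicGeometry.RelativeSpec.FiniteGroupQuotientGluedProperties
import Literature.AlgebraicGeometry.RelativeSpec.SymmetricPowerGlued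
import Literature.AlgebraicGeometry.Resolution.TameQuotientSingularitiesResolution
import Literature.AlgebraicGeometry.Resolution.ResolutionOfCurves
import Literature.AlgebraicGeometry.Resolution.ComponentGluing
import Literature.AlgebraicGeometry.Resolution.AlterationsResolution

/-!
# `stub_exitAssemblyBR` PROVED (draft form) — line B `s1a-tamebr` on crux stmt-ResolutionOfSingularities-17941

[OURS · L1 W4.5c · idea-2 g15] — NOT a statement of the manuscript; counted 0.

The skeleton `L/res-L1-w45c-plan-1/s1a/line-s1a-tamebr.lean` (42542c5a4af4dffc) carries
`stub_exitAssemblyBR : BerghRydh2019_diagonalizableQuotientResolution → ∀ p, p.Prime → S1.GlobalKillBR p →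
S1.CyclicQuotientAt p` as a sorried stub. This file PROVES it, sorry-free, against LOCAL VERBATIM COPIES
`D2TDraft.BRExitCover / KillBRModel / GlobalKillBR` of the D2-T v2 decls (8e2166438e9633e2; the module
`…S1KillExitDefsTame` is being filed by stub-3 and is not importable yet). Once it lands, replace the three
local defs by `import …S1KillExitDefsTame` and the names `S1.BRExitCover`, `S1.KillBRModel`, `S1.GlobalKillBR`
(bodies byte-identical ⇒ the proofs go through unchanged) and land as `--supports` the registered stub.

Proof (the tree already has every brick; compare `TameQuotient.hasResolution_of_faithful_of_berghRydh`, which is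
the `π = 𝟙` case with the tame fact): dimension `0` by `hasResolution_of_dim_le_one`; `ρ` not faithful ⇒ (`|G| = p`
prime) `ρ` trivial ⇒ `q` bijective, finite, generically étale ⇒ birational (`Birational.stub_birational_of_bijective`)
and the regular `X′` itself resolves `X₁`; `ρ` faithful ⇒ unpack the KILL-BR model `(V, π, ρB, cover)`: the action on
`V` is faithful (`ext_of_isDominant` along the dominant `π`), `r : V/G → X₁` is proper (`ActionOver.isProper_gluedDesc`)
and birational (W-clause `QuotientModel.exists_dense_isFinite_etale_bijective` + `stub_birational_of_bijective`),
`V/G → Spec k` inherits separated / locally-of-finite-type / quasi-compact from `r ≫ f`, the named fact applied to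
the cover gives `HasResolution (V/G)`, and resolutions transfer along `r` (`Scheme.HasResolution.of_isBirational`).
-/

set_option linter.dupNamespace false

noncomputable section

open CategoryTheory Limits AlgebraicGeometry TopologicalSpace
open Literature.AlgebraicGeometry.Resolution Literature.AlgebraicGeometry.RelativeSpec

namespace Summit.ResolutionOfSingularities.ResolutionOfSingularities.Theorems.WildQuotientResolution.S1.ExitAssemblyBR

/-- **Faithful case.** A KILL-BR model of a faithful datum over a perfect field resolves `X₁`
(positive dimension). [OURS · L1 W4.5c] -/
theorem hasResolution_of_killBRModel (hBR : BerghRydh2019_diagonalizableQuotientResolution)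
    {k : Type} [Field k] [PerfectField k] {X' X₁ : Scheme.{0}} (f : X₁ ⟶ Spec (.of k))
    [IsSeparated f] [LocallyOfFiniteType f] [QuasiCompact f] [IsIntegral X₁] [IsIntegral X']
    (q : X' ⟶ X₁) [IsFinite q] (G : Type) [Group G] [Finite G] (ρ : G →* Aut X')
    (hinj : Function.Injective ρ) (hsurj : Function.Surjective q.base)
    (hU : ∃ U : X₁.Opens, Dense (U : Set X₁) ∧ Etale (q ∣_ U))
    (horb : ∀ x y : X', q.base x = q.base y → ∃ g : G, (ρ g).hom.base x = y)
    (hdim : ¬ topologicalKrullDim X₁ ≤ 0) (h : KillBRModel f q G ρ) :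
    Scheme.HasResolution X₁ := by
  classical
  obtain ⟨V, π, hX₁sep, hsep, ρB, hπprop, hπbir, hVint, -, hequiv, hcov, hcover⟩ := h
  haveI := hX₁sep
  haveI := hsep
  haveI := hπprop
  haveI := hVint
  haveI : IsLocallyNoetherian X₁ := LocallyOfFiniteType.isLocallyNoetherian f
  haveI : X'.IsSeparated := ⟨by rw [← terminal.comp_from (q ≫ f)]; infer_instance⟩
  haveI : IsDominant π := hπbir.isDominant
  -- the action on `V` is faithful
  have hinjB : Function.Injective ρB.aut := by
    intro g g' hgg'
    apply hinj
    have hc : π ≫ (ρ g).hom = π ≫ (ρ g').hom := by rw [← hequiv g, ← hequiv g', hgg']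
    exact Iso.ext (ext_of_isDominant π hc)
  -- the quotient `r : V/G → X₁` is proper and birational
  haveI hY : IsIntegral ρB.glued := ρB.isIntegral_glued hcov
  haveI hr : IsProper (ρB.gluedDesc (π ≫ q) ρB.aut_comp) :=
    ρB.isProper_gluedDesc hcov (π ≫ q) ρB.aut_comp (𝟙 X₁) (Category.comp_id _)
  obtain ⟨W, hWd, hWfin, hWet, hWbij⟩ :=
    QuotientModel.exists_dense_isFinite_etale_bijective π q ρB hcov hinjB ρ hequiv horb hsurj hU hπbir
  haveI := hWfin
  haveI := hWet
  have hrbir : IsBirational (ρB.gluedDesc (π ≫ q) ρB.aut_comp) :=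
    Birational.stub_birational_of_bijective k f (ρB.gluedDesc (π ≫ q) ρB.aut_comp) hdim W hWd hWbij
  -- `V/G` has a resolution by Bergh–Rydh (the structure map `r ≫ f` inherits the instance binders)
  have hYres : Scheme.HasResolution ρB.glued :=
    hBR k ρB.glued (ρB.gluedDesc (π ≫ q) ρB.aut_comp ≫ f) hcover
  exact ComponentGluing.Scheme.HasResolution.of_isBirational (ρB.gluedDesc (π ≫ q) ρB.aut_comp) hrbir hYres

/-- **Trivial-action case.** If `ρ` is trivial the fibres-are-orbits hypothesis makes `q` injective, so the finite,
surjective, generically étale `q : X′ → X₁` is birational and the regular `X′` resolves `X₁`. [OURS · L1 W4.5c] -/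
theorem hasResolution_of_trivial_action {k : Type} [Field k] {X' X₁ : Scheme.{0}} (f : X₁ ⟶ Spec (.of k))
    [LocallyOfFiniteType f] [IsIntegral X₁] [IsIntegral X']
    (q : X' ⟶ X₁) [IsFinite q] (G : Type) [Group G] (ρ : G →* Aut X') (htriv : ∀ g : G, ρ g = 1)
    (hreg : Scheme.IsRegular X') (hsurj : Function.Surjective q.base)
    (hU : ∃ U : X₁.Opens, Dense (U : Set X₁) ∧ Etale (q ∣_ U))
    (horb : ∀ x y : X', q.base x = q.base y → ∃ g : G, (ρ g).hom.base x = y)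
    (hdim : ¬ topologicalKrullDim X₁ ≤ 0) : Scheme.HasResolution X₁ := by
  classical
  have hqinj : Function.Injective q.base := fun x y hxy => by
    obtain ⟨g, hg⟩ := horb x y hxy
    rw [htriv g] at hg
    have hg' : ((Iso.refl X').hom).base x = y := hg
    simpa using hg'
  obtain ⟨U, hUd, hUet⟩ := hU
  haveI := hUet
  haveI : IsFinite (q ∣_ U) := IsZariskiLocalAtTarget.restrict (P := @IsFinite) inferInstance U
  have hbij : Function.Bijective (q ∣_ U).base := by
    refine ⟨fun a b hab => ?_, fun u => ?_⟩
    · have hab' := congrArg Subtype.val hab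
      simp only [morphismRestrict_base_coe] at hab'
      exact Subtype.ext (hqinj hab')
    · obtain ⟨x, hx⟩ := hsurj u.1
      have hxU : x ∈ q ⁻¹ᵁ U := show q.base x ∈ U by rw [hx]; exact u.2
      exact ⟨⟨x, hxU⟩, Subtype.ext (by rw [morphismRestrict_base_coe]; exact hx)⟩
  have hqbir : IsBirational q := Birational.stub_birational_of_bijective k f q hdim U hUd hbij
  have hX'res : Scheme.HasResolution X' :=
    ⟨X', 𝟙 X', ⟨inferInstance, ⟨⊤, by simp, by simp, inferInstance⟩, hreg⟩⟩
  exact ComponentGluing.Scheme.HasResolution.of_isBirational q hqbir hX'res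

/-- **`stub_exitAssemblyBR`, proved** (draft names): the named fact and `GlobalKillBR p` give `CyclicQuotientAt p`.
[OURS · L1 W4.5c] -/
theorem cyclicQuotientAt_of_globalKillBR (hBR : BerghRydh2019_diagonalizableQuotientResolution)
    (p : ℕ) (hp : p.Prime) (hG : GlobalKillBR p) : S1.CyclicQuotientAt p := by
  intro k _ _ _ X' X₁ f q G _ _ ρ hcard hsep hlft hqc hX₁ hX' hreg hfin hsurj hU hρ horb hdim
  haveI := hsep
  haveI := hlft
  haveI := hqc
  haveI := hX₁
  haveI := hX'
  haveI := hfin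
  classical
  by_cases hdim0 : topologicalKrullDim X₁ ≤ 0
  · exact hasResolution_of_dim_le_one X₁ f (hdim0.trans zero_le_one)
  by_cases hinj : Function.Injective ρ
  · exact hasResolution_of_killBRModel hBR f q G ρ hinj hsurj hU horb hdim0
      (hG k X' X₁ f q G ρ hcard hsep hlft hqc hX₁ hX' hreg hfin hsurj hU hρ horb hdim hinj)
  · -- `|G| = p` prime and `ρ` not injective ⇒ `ρ` trivial
    have htriv : ∀ g : G, ρ g = 1 := by
      haveI : Fact (Nat.card G).Prime := ⟨by rw [hcard]; exact hp⟩
      rcases ρ.ker.eq_bot_or_eq_top_of_prime_card with h | h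
      · exact absurd ((MonoidHom.ker_eq_bot_iff ρ).mp h) hinj
      · intro g
        exact (MonoidHom.mem_ker).mp (h ▸ Subgroup.mem_top g)
    exact hasResolution_of_trivial_action f q G ρ htriv hreg hsurj hU horb hdim0

/-- The registered stub statement of line `s1a-tamebr`, VERBATIM (plan-1 LANDING ORDER 19:22:32Z (3)). [OURS · L1 W4.5c] -/
theorem stub_exitAssemblyBR_holds :
    BerghRydh2019_diagonalizableQuotientResolution → ∀ p : ℕ, p.Prime → GlobalKillBR p → CyclicQuotientAt p :=
  cyclicQuotientAt_of_globalKillBR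

end Summit.ResolutionOfSingularities.ResolutionOfSingularities.Theorems.WildQuotientResolution.S1.ExitAssemblyBR

end
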